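import Literature.Geometry.Riemannian.TensionField
import Literature.Geometry.Riemannian.EnergyMinimisingMaps
import Literature.Geometry.Lorentzian.TwoParameterMaps
import Literature.Geometry.Lorentzian.GeodesicSpeed
import Literature.Geometry.Lorentzian.CurveThroughVelocity
import Literature.Geometry.Lorentzian.CurvatureRegularity
import Literature.Geometry.Lorentzian.MeanCurvatureRegularity
import Literature.Geometry.Lorentzian.ChartLaplacian
import Literature.Geometry.Lorentzian.TwoParameterFrame
import Literature.Geometry.Lorentzian.DivergenceTheorem
import HarnessLib

/-!
# The first-variation formula for the energy of maps and `τ(φ) ≡ 0 ⇒ φ` is harmonic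
(topic `Geometry/Riemannian`; Eells–Ratto 1993, Ch. I, (1.9) Theorem and its proof, Steps 1–2)

The bridge between the variational notion of harmonic map of the tree
(`Literature.Geometry.Riemannian.IsHarmonicMap`, `HarmonicMaps.lean`: `C^∞` critical point of
the energy `E`) and the Euler–Lagrange equation `τ(φ) = 0` (tension field,
`HarmonicMap.tensionField`, `TensionField.lean`), needed by every analytic construction of
harmonic maps and in particular by both lines of attack on the named fact
`Literature.Geometry.Riemannian.eellsSampson_existence` (Eells–Sampson's heat flow produces a limit
with `τ = 0`; so does minimisation). Eells–Ratto 1993, Ch. I (1.9) **Theorem.** "A map `φ` is a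
critical point of `E` iff it is harmonic", proof (held copy, PDF pp. 14–15, READ):
Step 1 "`d/dt E(φ_t)|₀ = ½∫_M ∂/∂t⟨dφ_t, dφ_t⟩|₀ dx = ∫_M ⟨∇_{∂ₜ}dφ_t, dφ_t⟩|₀ dx`" with
"`(∇_{∂ₜ} dφ_t)(X) = ∇^Φ_X(dΦ·∂ₜ)`", hence "`dE(φ_t)/dt|₀ = ∫_M ⟨∇^φ v, dφ⟩ dx`";
Step 2 "`∫_M ⟨∇^φ v, dφ⟩ dx = ∫_M ⟨v, ∇^* dφ⟩ dx`", `∇^* dφ = −Trace ∇dφ = −τ(φ)`. Everything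
below is PROVED; there are no definitions and no named facts.

* **Step 1** (any models; `x` an interior point): for a `C^∞` deformation `F` with variation
  field `V = ∂ₜF(t₀, ·)` along `φ = F t₀`,
  `covariantDerivAlong_mfderiv_stage : D_t|_{t₀} dF_t(v) = D_v V` (the symmetry lemma
  `D_t ∂_s = D_s ∂_t` for the two-parameter map `(t, s) ↦ F t (c_v s)`, O'Neill 1983, Ch. 4,
  Prop. 44 (1), `covariantDerivAlong_velocity_comm` of `TwoParameterMaps.lean`; `D_v V` is
  `PseudoRiemannianMetric.normalDerivAlong`), `hasDerivAt_val_mfderiv_stage :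
  ∂ₜ h(dF_t v, dF_t w) = h(D_v V, dφ w) + h(dφ v, D_w V)` (product rule along `t ↦ F t x`,
  `hasDerivAt_val_apply_along` of `GeodesicSpeed.lean`), and `hasDerivAt_energyDensity_stage`
  (summing over the coordinate frame, `energyDensity_eq_sum_frame`).
* **The variation field is smooth**: `contMDiff_lift_velocity_stage` (family read in a chart,
  `contMDiffAt_lift_mfderiv_const'`).
* **Step 2, pointwise** (any models): with the dual field `Y_V = (h(V, dφ·))^♯` on `M`
  (`val_sharp_varDual`, smooth: `contMDiff_varDual`):
  `mvfderiv_val_mfderiv_apply : w(h(V, dφ Z)) = h(D_w V, dφ Z) + h(V, D_w(dφ Z))`,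
  `val_leviCivita_varDual : g(∇_w Y_V, Z) = h(D_w V, dφ Z) + h(V, ∇dφ(w, Z))` (metric
  compatibility of the Levi-Civita connection of `g`; `∇dφ = HarmonicMap.secondFF`),
  `vectorDivergence_varDual_eq_sum` (trace in the frame, `linearMapTrace_eq_sum_gram_inv`), and
  the **pointwise first-variation identity**
  `deriv_energyDensity_stage_eq : ∂ₜ e(F_t)(x)|_{t₀} = div Y_V (x) − h(V, τ(F t₀))(x)`
  (`div = PseudoRiemannianMetric.vectorDivergence` of `DivergenceTheorem.lean`).
* **Step 3, integrated** (closed `M` modelled on `ℝ^m`, the setting of the tree's Green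
  identity / divergence theorem): `hasDerivAt_energy_stage_eq_neg_integral :
  d/dt|_{t₀} E(F_t) = −∫_M h(τ(F_{t₀}), ∂ₜF(t₀, ·)) dμ_g` (`hasDerivAt_energy_family` of
  `EnergyMinimisingMaps.lean` and the divergence theorem `integral_vectorDivergence_eq_zero`),
  and **`isHarmonicMap_of_tensionField_eq_zero`: a smooth map with `τ(φ) ≡ 0` is harmonic**
  (Eells–Ratto (1.9), direction "⇐"; Carlson–Müller-Stach–Peters 2017, p. 345, Theorem
  "Characterization of harmonic maps": "The converse is obvious").

The converse direction (a critical point has `τ = 0`) needs deformations with a prescribed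
variation field (`φ_t(x) = exp_{φ(x)}(t v(x))`, Eells–Ratto (1.8)) and is not treated here.

## References

* J. Eells, A. Ratto, *Harmonic Maps and Minimal Immersions with Symmetries*, Ann. of Math.
  Studies 130, Princeton Univ. Press 1993, Ch. I, (1.3), (1.5), (1.7), (1.8)–(1.9) and the proof of
  (1.9), Steps 1–2. Held copy, PDF pp. 13–15. [EellsRatto1993]
* J. Eells, J. H. Sampson, *Harmonic mappings of Riemannian manifolds*, Amer. J. Math. 86 (1964)
  109–160, §2 (first variation of the energy, tension field). [EellsSampson1964]
* J. Carlson, S. Müller-Stach, C. Peters, *Period Mappings and Period Domains*, 2nd ed. (2017),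
  §14.1, p. 345 (characterization of harmonic maps), Thm. 14.1.3. [CarlsonMullerStachPeters2017]
* B. O'Neill, *Semi-Riemannian Geometry*, Academic Press 1983, Ch. 3, Prop. 18 (induced covariant
  derivative, product rule), Ch. 4, pp. 98–99, 122–123, Prop. 44 (1) (two-parameter maps,
  symmetry lemma). [ONeill1983]
-/

noncomputable section

open Bundle Set Function Filter
open scoped Manifold ContDiff Topology

namespace Literature.Geometry.Riemannian

open Lorentzian Lorentzian.PseudoRiemannianMetric

namespace HarmonicMap

variable {EM : Type*} [NormedAddCommGroup EM] [NormedSpace ℝ EM] [FiniteDimensional ℝ EM]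
  {HM : Type*} [TopologicalSpace HM] {IM : ModelWithCorners ℝ EM HM} [IM.Boundaryless]
  {M : Type*} [TopologicalSpace M] [ChartedSpace HM M] [IsManifold IM ∞ M]
  {EN : Type*} [NormedAddCommGroup EN] [NormedSpace ℝ EN] [FiniteDimensional ℝ EN]
  [CompleteSpace EN] {HN : Type*} [TopologicalSpace HN] {IN : ModelWithCorners ℝ EN HN}
  {N : Type*} [TopologicalSpace N] [ChartedSpace HN N] [IsManifold IN ∞ N]

variable (h : PseudoRiemannianMetric IN ∞ EN (TangentSpace IN : N → Type _)) [h.HasLeviCivita]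

/-! ### The two-parameter maps `(t, s) ↦ F t (c_v s)` of a family of maps -/

omit [IM.Boundaryless] [IsManifold IM ∞ M] [FiniteDimensional ℝ EM] [CompleteSpace EN] in
/-- `covariantDerivAlong` only depends on the lifted curve `t ↦ (γ t, W t) ∈ TN`: if two pairs
`(γ, W)`, `(γ', W')` have the same lift, their covariant derivatives agree (as elements of the
model space). [folklore] -/
theorem covariantDerivAlong_congr_lift {γ γ' : ℝ → N} {W : Π t : ℝ, TangentSpace IN (γ t)}
    {W' : Π t : ℝ, TangentSpace IN (γ' t)}
    (hlift : (fun t ↦ (TotalSpace.mk' EN (γ t) (W t) : TangentBundle IN N)) =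
      fun t ↦ (TotalSpace.mk' EN (γ' t) (W' t) : TangentBundle IN N)) (t₀ : ℝ) :
    (covariantDerivAlong h.leviCivita γ W t₀ : EN) = covariantDerivAlong h.leviCivita γ' W' t₀ := by
  have hγ : γ = γ' := by
    funext t
    exact congrArg TotalSpace.proj (congrFun hlift t)
  subst hγ
  have hW : W = W' := by
    funext t
    have := congrFun hlift t
    rw [Bundle.TotalSpace.mk_inj] at this
    exact this
  subst hW
  rfl


section TwoParameter

variable {F : ℝ → M → N}
  (hF : ContMDiff (𝓘(ℝ, ℝ).prod IM) IN ∞ (fun p : ℝ × M ↦ F p.1 p.2))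
include hF

omit [FiniteDimensional ℝ EM] [FiniteDimensional ℝ EN] [CompleteSpace EN] [IM.Boundaryless]
  [IsManifold IM ∞ M] [IsManifold IN ∞ N] in
/-- Each stage `F t` of a jointly `C^∞` family is `C^∞`. [folklore] -/
theorem contMDiff_stage (t : ℝ) : ContMDiff IM IN ∞ (F t) :=
  hF.comp (contMDiff_const.prodMk contMDiff_id)

omit [FiniteDimensional ℝ EM] [FiniteDimensional ℝ EN] [CompleteSpace EN] [IsManifold IN ∞ N] in
/-- The two-parameter map `(t, s) ↦ F t (c s)` obtained from a jointly `C^∞` family of maps and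
the chart-straight curve `c = curveThrough IM x v` is `C^∞` at `(t, 0)`
(`contMDiffAt_curveThrough_zero`). O'Neill 1983, Ch. 4, p. 122 (two-parameter maps).
[cite: ONeill1983, Ch. 4, p. 122] -/
theorem contMDiffAt_uncurry_comp_curveThrough (x : M) (v : TangentSpace IM x) (t : ℝ) :
    ContMDiffAt (𝓘(ℝ, ℝ).prod 𝓘(ℝ, ℝ)) IN ∞
      (uncurry fun t s ↦ F t (curveThrough IM x v s)) (t, 0) := by
  have hc : ContMDiffAt 𝓘(ℝ, ℝ) IM ∞ (curveThrough IM x v) ((t, (0 : ℝ)) : ℝ × ℝ).2 :=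
    contMDiffAt_curveThrough_zero (n := ∞) x v
  have hψ : ContMDiffAt (𝓘(ℝ, ℝ).prod 𝓘(ℝ, ℝ)) (𝓘(ℝ, ℝ).prod IM) ∞
      (fun q : ℝ × ℝ ↦ (q.1, curveThrough IM x v q.2)) (t, 0) :=
    contMDiffAt_fst.prodMk (hc.comp (t, 0) contMDiffAt_snd)
  exact (hF.contMDiffAt).comp (t, 0) hψ

omit [FiniteDimensional ℝ EM] [FiniteDimensional ℝ EN] [CompleteSpace EN] [IsManifold IN ∞ N] in
/-- **The `s`-velocity of `(t, s) ↦ F t (c_v s)` at `s = 0` is `dF_t(v)`** (chain rule and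
`velocity_curveThrough_zero_holds`; a cross-fibre equation, both sides in the model space
`EN`). O'Neill 1983, Ch. 4, p. 122. [cite: ONeill1983, Ch. 4, p. 122] -/
theorem velocity_stage_comp_curveThrough (x : M) (v : TangentSpace IM x) (t : ℝ) :
    (velocity IN (fun s ↦ F t (curveThrough IM x v s)) 0 : EN) = mfderiv IM IN (F t) x v := by
  have hc : MDifferentiableAt 𝓘(ℝ, ℝ) IM (curveThrough IM x v) 0 :=
    (contMDiffAt_curveThrough_zero (n := 1) x v).mdifferentiableAt one_ne_zero
  have hv : velocity IM (curveThrough IM x v) 0 = v :=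
    velocity_curveThrough_zero_holds BoundarylessManifold.isInteriorPoint v
  have hFt : MDifferentiableAt IM IN (F t) x := (contMDiff_stage hF t x).mdifferentiableAt (by simp)
  have h1 := mfderiv_comp_apply_of_eq (hg := hFt) (hf := hc) (hy := curveThrough_zero IM x v)
    (v := (1 : ℝ))
  exact h1.trans (congrArg (mfderiv IM IN (F t) x) hv)

omit [FiniteDimensional ℝ EM] [FiniteDimensional ℝ EN] [CompleteSpace EN] in
/-- **Differentiability of the lift of `t ↦ dF_t(v)` to `TN`** along the curve `t ↦ F t x`: it is
the lift of the `s`-velocity field of the two-parameter map `(t, s) ↦ F t (c_v s)`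
(`mdifferentiableAt_lift_velocity_curry_right`). O'Neill 1983, Ch. 4, p. 122.
[cite: ONeill1983, Ch. 4, p. 122] -/
theorem mdifferentiableAt_lift_mfderiv_stage (x : M) (v : TangentSpace IM x) (t₀ : ℝ) :
    MDifferentiableAt 𝓘(ℝ, ℝ) IN.tangent
      (fun t ↦ (TotalSpace.mk' EN (F t x) (mfderiv IM IN (F t) x v) : TangentBundle IN N)) t₀ := by
  have hl := mdifferentiableAt_lift_velocity_curry_right
    ((contMDiffAt_uncurry_comp_curveThrough hF x v t₀).of_le (by norm_cast))
  have heq : (fun t ↦ (TotalSpace.mk' EN ((fun t s ↦ F t (curveThrough IM x v s)) t 0)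
      (velocity IN ((fun t s ↦ F t (curveThrough IM x v s)) t) 0) : TangentBundle IN N)) =
      fun t ↦ (TotalSpace.mk' EN (F t x) (mfderiv IM IN (F t) x v) : TangentBundle IN N) := by
    funext t
    congr 1
    · exact congrArg (F t) (curveThrough_zero IM x v)
    · exact velocity_stage_comp_curveThrough hF x v t
  rwa [heq] at hl

omit [FiniteDimensional ℝ EM] in
/-- **The covariant derivative of `t ↦ dF_t(v)` along `t ↦ F t x` is the covariant derivative of
the variation field `∂ₜF` along `F t₀` in the direction `v`** — the symmetry lemma
`D_t ∂_s = D_s ∂_t` for the two-parameter map `(t, s) ↦ F t (c_v s)` (O'Neill 1983, Ch. 4,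
Prop. 44 (1), `covariantDerivAlong_velocity_comm`; Eells–Ratto 1993, Ch. I, proof of (1.9),
Step 1: "`(∇_{∂ₜ} dφ_t)(X) = ∇^Φ_X (dΦ · ∂ₜ)`"). The right-hand side is, by definition,
`PseudoRiemannianMetric.normalDerivAlong` of the field `y ↦ ∂ₜF(t₀, y)` along `F t₀`.
[cite: EellsRatto1993, Ch. I (1.9), proof, Step 1] [cite: ONeill1983, Ch. 4, Prop. 44 (1)] -/
theorem covariantDerivAlong_mfderiv_stage (x : M) (v : TangentSpace IM x) (t₀ : ℝ) :
    covariantDerivAlong h.leviCivita (fun t ↦ F t x) (fun t ↦ mfderiv IM IN (F t) x v) t₀ =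
      h.normalDerivAlong (F t₀) (fun y ↦ velocity IN (fun t ↦ F t y) t₀) x v := by
  have htors : h.leviCivita.torsion = 0 := (isLeviCivita_leviCivita_holds (g := h)).1
  have hcomm := covariantDerivAlong_velocity_comm h.leviCivita htors
    ((contMDiffAt_uncurry_comp_curveThrough hF x v t₀).of_le (by norm_cast))
  -- the left-hand side of the symmetry lemma is the left-hand side of the claim
  have hlhs : covariantDerivAlong h.leviCivita (fun t ↦ (fun t s ↦ F t (curveThrough IM x v s)) t 0)
      (fun t ↦ velocity IN ((fun t s ↦ F t (curveThrough IM x v s)) t) 0) t₀ =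
      covariantDerivAlong h.leviCivita (fun t ↦ F t x) (fun t ↦ mfderiv IM IN (F t) x v) t₀ := by
    have h1 : (fun t ↦ (TotalSpace.mk' EN ((fun t s ↦ F t (curveThrough IM x v s)) t 0)
        (velocity IN ((fun t s ↦ F t (curveThrough IM x v s)) t) 0) : TangentBundle IN N)) =
        fun t ↦ (TotalSpace.mk' EN (F t x) (mfderiv IM IN (F t) x v) : TangentBundle IN N) := by
      funext t
      congr 1
      · exact congrArg (F t) (curveThrough_zero IM x v)
      · exact velocity_stage_comp_curveThrough hF x v t
    exact covariantDerivAlong_congr_lift h h1 t₀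
  rw [← hlhs, hcomm]
  rfl

end TwoParameter

/-! ### Step 1: the time derivative of the energy density -/

section StepOne

variable {F : ℝ → M → N}
  (hF : ContMDiff (𝓘(ℝ, ℝ).prod IM) IN ∞ (fun p : ℝ × M ↦ F p.1 p.2))
include hF

omit [FiniteDimensional ℝ EM] in
/-- **Derivative of a metric coefficient `h(dF_t v, dF_t w)` along a smooth deformation**
(Eells–Ratto 1993, Ch. I, proof of (1.9), Step 1: `∂ₜ ⟨dφ_t, dφ_t⟩ = 2⟨∇_{∂ₜ} dφ_t, dφ_t⟩` and
`(∇_{∂ₜ} dφ_t)(X) = ∇^Φ_X(dΦ·∂ₜ)`): for `x ∈ M`, `v, w ∈ T_x M`,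
`d/dt|_{t₀} h(dF_t v, dF_t w) = h(D_v V, dF_{t₀} w) + h(dF_{t₀} v, D_w V)` with `V = ∂ₜF(t₀, ·)`
the variation field along `F t₀` and `D_v V` its covariant derivative along `F t₀`
(`normalDerivAlong`): the product rule along the curve `t ↦ F t x`
(`hasDerivAt_val_apply_along`) and the symmetry lemma (`covariantDerivAlong_mfderiv_stage`).
[cite: EellsRatto1993, Ch. I (1.9), proof, Step 1] -/
theorem hasDerivAt_val_mfderiv_stage (x : M) (v w : TangentSpace IM x) (t₀ : ℝ) :
    HasDerivAt (fun t ↦ h.val (F t x) (mfderiv IM IN (F t) x v) (mfderiv IM IN (F t) x w))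
      (h.val (F t₀ x) (h.normalDerivAlong (F t₀) (fun y ↦ velocity IN (fun t ↦ F t y) t₀) x v)
          (mfderiv IM IN (F t₀) x w) +
        h.val (F t₀ x) (mfderiv IM IN (F t₀) x v)
          (h.normalDerivAlong (F t₀) (fun y ↦ velocity IN (fun t ↦ F t y) t₀) x w)) t₀ := by
  have hcompat : h.IsCompatible h.leviCivita := (isLeviCivita_leviCivita_holds (g := h)).2
  have hd := hasDerivAt_val_apply_along (g := h) hcompat
    (mdifferentiableAt_lift_mfderiv_stage hF x v t₀) (mdifferentiableAt_lift_mfderiv_stage hF x w t₀)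
  rw [covariantDerivAlong_mfderiv_stage h hF x v t₀, covariantDerivAlong_mfderiv_stage h hF x w t₀]
    at hd
  exact hd

variable (g : ContMDiffRiemannianMetric IM ∞ EM (TangentSpace IM : M → Type _))

omit hF [IM.Boundaryless] [CompleteSpace EN] [FiniteDimensional ℝ EN] [h.HasLeviCivita] in
/-- **The energy density in the coordinate frame at the point**:
`e(φ)(x) = ½ ∑ᵢⱼ (𝒢(x)⁻¹)ⱼᵢ h(dφ ∂ᵢ, dφ ∂ⱼ)`, `∂ᵢ` the local frame of the trivialisation of `TM`
at `x` itself and `𝒢` its Gram matrix (`trace_eq_sum_gram_inv`; Eells–Ratto 1993, Ch. I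
(1.3): "`e(φ)(x) = ½ gⁱʲ(x) φᵢ^α(x) φⱼ^β(x) h_{αβ}(φ(x))`"). [cite: EellsRatto1993, Ch. I (1.3)] -/
theorem energyDensity_eq_sum_frame (φ : M → N) (x : M) :
    energyDensity g h φ x = (1 / 2 : ℝ) * ∑ i, ∑ j,
      (Matrix.of fun i j ↦ (ofRiemannian g).val x
          ((trivializationAt EM (TangentSpace IM : M → Type _) x).localFrame
            (Module.finBasis ℝ EM) i x)
          ((trivializationAt EM (TangentSpace IM : M → Type _) x).localFrame
            (Module.finBasis ℝ EM) j x))⁻¹ j i *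
        h.val (φ x)
          (mfderiv IM IN φ x ((trivializationAt EM (TangentSpace IM : M → Type _) x).localFrame
            (Module.finBasis ℝ EM) i x))
          (mfderiv IM IN φ x ((trivializationAt EM (TangentSpace IM : M → Type _) x).localFrame
            (Module.finBasis ℝ EM) j x)) := by
  classical
  have hx : x ∈ (trivializationAt EM (TangentSpace IM : M → Type _) x).baseSet :=
    FiberBundle.mem_baseSet_trivializationAt' x
  rw [energyDensity_eq, trace_eq_sum_gram_inv (ofRiemannian g) x
    ((trivializationAt EM (TangentSpace IM : M → Type _) x).basisAt (Module.finBasis ℝ EM) hx)]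
  simp only [(trivializationAt EM (TangentSpace IM : M → Type _) x).localFrame_apply_of_mem_baseSet
    (Module.finBasis ℝ EM) hx]
  rfl

/-- **Step 1 of the first-variation formula, raw form** (Eells–Ratto 1993, Ch. I, proof of
(1.9), Step 1: "`d/dt E(φ_t)|₀ = ½ ∫_M ∂/∂t ⟨dφ_t, dφ_t⟩|₀ dx = ∫_M ⟨∇_{∂ₜ} dφ_t, dφ_t⟩|₀ dx`",
pointwise and at any time `t₀`): the energy density of a smooth deformation has time
derivative `½ ∑ᵢⱼ (𝒢⁻¹)ⱼᵢ [h(D_{∂ᵢ} V, dφ ∂ⱼ) + h(dφ ∂ᵢ, D_{∂ⱼ} V)]` at `t₀`, where `φ = F t₀`,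
`V = ∂ₜF(t₀, ·)` and `D` is the covariant derivative along `φ`
(`hasDerivAt_val_mfderiv_stage` summed over the frame; the Gram matrix does not depend on `t`).
[cite: EellsRatto1993, Ch. I (1.9), proof, Step 1] -/
theorem hasDerivAt_energyDensity_stage (x : M) (t₀ : ℝ) :
    HasDerivAt (fun t ↦ energyDensity g h (F t) x)
      ((1 / 2 : ℝ) * ∑ i, ∑ j,
        (Matrix.of fun i j ↦ (ofRiemannian g).val x
            ((trivializationAt EM (TangentSpace IM : M → Type _) x).localFrame
              (Module.finBasis ℝ EM) i x)
            ((trivializationAt EM (TangentSpace IM : M → Type _) x).localFrame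
              (Module.finBasis ℝ EM) j x))⁻¹ j i *
          (h.val (F t₀ x)
              (h.normalDerivAlong (F t₀) (fun y ↦ velocity IN (fun t ↦ F t y) t₀) x
                ((trivializationAt EM (TangentSpace IM : M → Type _) x).localFrame
                  (Module.finBasis ℝ EM) i x))
              (mfderiv IM IN (F t₀) x
                ((trivializationAt EM (TangentSpace IM : M → Type _) x).localFrame
                  (Module.finBasis ℝ EM) j x)) +
            h.val (F t₀ x)
              (mfderiv IM IN (F t₀) x
                ((trivializationAt EM (TangentSpace IM : M → Type _) x).localFrame
                  (Module.finBasis ℝ EM) i x))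
              (h.normalDerivAlong (F t₀) (fun y ↦ velocity IN (fun t ↦ F t y) t₀) x
                ((trivializationAt EM (TangentSpace IM : M → Type _) x).localFrame
                  (Module.finBasis ℝ EM) j x)))) t₀ := by
  have hfun : (fun t ↦ energyDensity g h (F t) x) = fun t ↦ (1 / 2 : ℝ) * ∑ i, ∑ j,
      (Matrix.of fun i j ↦ (ofRiemannian g).val x
          ((trivializationAt EM (TangentSpace IM : M → Type _) x).localFrame
            (Module.finBasis ℝ EM) i x)
          ((trivializationAt EM (TangentSpace IM : M → Type _) x).localFrame
            (Module.finBasis ℝ EM) j x))⁻¹ j i *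
        h.val (F t x)
          (mfderiv IM IN (F t) x ((trivializationAt EM (TangentSpace IM : M → Type _) x).localFrame
            (Module.finBasis ℝ EM) i x))
          (mfderiv IM IN (F t) x ((trivializationAt EM (TangentSpace IM : M → Type _) x).localFrame
            (Module.finBasis ℝ EM) j x)) :=
    funext fun t ↦ energyDensity_eq_sum_frame h g (F t) x
  rw [hfun]
  refine HasDerivAt.const_mul _ (HasDerivAt.fun_sum fun i _ ↦ HasDerivAt.fun_sum fun j _ ↦ ?_)
  exact (hasDerivAt_val_mfderiv_stage h hF x _ _ t₀).const_mul _

end StepOne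

/-! ### The variation field of a smooth family is a smooth field along the stage -/

section VariationField

omit [IM.Boundaryless] [IsManifold IM ∞ M] [FiniteDimensional ℝ EM] [FiniteDimensional ℝ EN]
  [CompleteSpace EN] [h.HasLeviCivita] in
/-- **The differential of a smooth map from a normed space, on a constant vector, is a smooth
map into the tangent bundle** (`contMDiffAt_lift_mfderiv_const` of `IMCFRegularity.lean`,
re-derived here to keep the inverse-mean-curvature-flow files out of the imports). For
`P : W → N` of class `C^∞` on an open set `D` of a normed space `W` and `v₀ ∈ W`,
`q ↦ (P q, dP_q v₀) ∈ TN` is `C^∞` at every `q ∈ D`: in the trivialisation of `TN` at `P q` its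
fibre coordinate is `D(φ ∘ P)_q v₀`. [folklore] -/
theorem contMDiffAt_lift_mfderiv_const' {W : Type*} [NormedAddCommGroup W] [NormedSpace ℝ W]
    {P : W → N} {D : Set W} (hD : IsOpen D) (hP : ContMDiffOn 𝓘(ℝ, W) IN ∞ P D) {q : W}
    (hq : q ∈ D) (v₀ : W) :
    ContMDiffAt 𝓘(ℝ, W) IN.tangent ∞ (fun q' ↦ (TotalSpace.mk' EN (P q')
      (mfderiv 𝓘(ℝ, W) IN P q' v₀) : TangentBundle IN N)) q := by
  set x₁ := P q with hx₁
  have hI1 : IsManifold IN (∞ + 1) N := inferInstanceAs (IsManifold IN ∞ N)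
  have hVB : ContMDiffVectorBundle ∞ EN (TangentSpace IN : N → Type _) IN :=
    TangentBundle.contMDiffVectorBundle
  have hPq : ContMDiffAt 𝓘(ℝ, W) IN ∞ P q := hP.contMDiffAt (hD.mem_nhds hq)
  have hsrc : (TotalSpace.mk' EN (P q) (mfderiv 𝓘(ℝ, W) IN P q v₀) : TangentBundle IN N) ∈
      (trivializationAt EN (TangentSpace IN : N → Type _) x₁).source := by
    rw [Trivialization.mem_source]; exact FiberBundle.mem_baseSet_trivializationAt' x₁
  refine ((trivializationAt EN (TangentSpace IN : N → Type _) x₁).contMDiffAt_iff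
    (f := fun q' ↦ (TotalSpace.mk' EN (P q') (mfderiv 𝓘(ℝ, W) IN P q' v₀) : TangentBundle IN N))
    hsrc).2 ⟨hPq, ?_⟩
  set D' : Set W := D ∩ P ⁻¹' (chartAt HN x₁).source with hD'
  have hD'o : IsOpen D' := hP.continuousOn.isOpen_inter_preimage hD (chartAt HN x₁).open_source
  have hqD' : q ∈ D' := ⟨hq, mem_chart_source HN x₁⟩
  have hΨ : ContDiffOn ℝ ∞ (extChartAt IN x₁ ∘ P) D' := by
    rw [← contMDiffOn_iff_contDiffOn]
    exact contMDiffOn_extChartAt.comp (hP.mono inter_subset_left) fun q' hq' ↦ hq'.2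
  have hdΨ : ContDiffOn ℝ ∞ (fun q' ↦ fderiv ℝ (extChartAt IN x₁ ∘ P) q' v₀) D' :=
    (hΨ.fderiv_of_isOpen hD'o le_rfl).clm_apply contDiffOn_const
  have hev : (fun q' ↦ ((trivializationAt EN (TangentSpace IN : N → Type _) x₁)
      (TotalSpace.mk' EN (P q') (mfderiv 𝓘(ℝ, W) IN P q' v₀) : TangentBundle IN N)).2) =ᶠ[𝓝 q]
      fun q' ↦ fderiv ℝ (extChartAt IN x₁ ∘ P) q' v₀ := by
    filter_upwards [hD'o.mem_nhds hqD'] with q' hq'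
    have hPq' : MDifferentiableAt 𝓘(ℝ, W) IN P q' :=
      (hP.contMDiffAt (hD.mem_nhds hq'.1)).mdifferentiableAt (by simp)
    have h1 := (mdifferentiableAt_extChartAt hq'.2).hasMFDerivAt.comp q' hPq'.hasMFDerivAt
    set L : W →L[ℝ] EN := (mfderiv IN 𝓘(ℝ, EN) (extChartAt IN x₁) (P q')).comp
      (mfderiv 𝓘(ℝ, W) IN P q') with hL
    have h2 : HasFDerivAt (extChartAt IN x₁ ∘ P) L q' := hasMFDerivAt_iff_hasFDerivAt.1 h1
    rw [← Trivialization.continuousLinearMapAt_apply_of_mem ℝ _ (by simpa using hq'.2),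
      TangentBundle.continuousLinearMapAt_trivializationAt hq'.2, h2.fderiv]
    rfl
  refine ContMDiffAt.congr_of_eventuallyEq ?_ hev
  exact (contMDiffOn_iff_contDiffOn.2 hdΨ).contMDiffAt (hD'o.mem_nhds hqD')

omit [IM.Boundaryless] [IsManifold IM ∞ M] [FiniteDimensional ℝ EM] [FiniteDimensional ℝ EN]
  [CompleteSpace EN] [h.HasLeviCivita] [IsManifold IN ∞ N] in
/-- **The time velocity of a family read in a chart is the differential of the chart expression on
`(1, 0)`**: for `P : ℝ × EM → N` differentiable at `(t, u)`,
`∂ₜ|_t P(·, u) = dP_{(t, u)}(1, 0)` (chain rule along `t' ↦ (t', u)`; a cross-fibre equation in the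
model space `EN`). [folklore] -/
theorem velocity_eq_mfderiv_chart {P : ℝ × EM → N} {t : ℝ} {u : EM}
    (hPd : MDifferentiableAt 𝓘(ℝ, ℝ × EM) IN P (t, u)) :
    (velocity IN (fun t' ↦ P (t', u)) t : EN) =
      mfderiv 𝓘(ℝ, ℝ × EM) IN P (t, u) ((1 : ℝ), (0 : EM)) := by
  have hc : HasMFDerivAt 𝓘(ℝ, ℝ) 𝓘(ℝ, ℝ × EM) (fun t' : ℝ ↦ ((t', u) : ℝ × EM)) t
      ((ContinuousLinearMap.id ℝ ℝ).prod (0 : ℝ →L[ℝ] EM)) :=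
    ((hasFDerivAt_id t).prodMk (hasFDerivAt_const u t)).hasMFDerivAt
  have hcomp : HasMFDerivAt 𝓘(ℝ, ℝ) IN (fun t' ↦ P (t', u)) t
      ((mfderiv 𝓘(ℝ, ℝ × EM) IN P (t, u)).comp
        ((ContinuousLinearMap.id ℝ ℝ).prod (0 : ℝ →L[ℝ] EM))) :=
    hPd.hasMFDerivAt.comp t hc
  simp only [velocity]
  rw [hcomp.mfderiv]
  rfl

variable {F : ℝ → M → N}
  (hF : ContMDiff (𝓘(ℝ, ℝ).prod IM) IN ∞ (fun p : ℝ × M ↦ F p.1 p.2))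
include hF

omit [FiniteDimensional ℝ EM] [FiniteDimensional ℝ EN] [CompleteSpace EN] [h.HasLeviCivita] [IM.Boundaryless]
  [IsManifold IN ∞ N] in
/-- **The family read in a chart of `M` is smooth**: `P(t, u) = F t (φ⁻¹ u)` is `C^∞` on
`ℝ × φ.target`, `φ = extChartAt IM y₀` (composition with `(t, u) ↦ (t, φ⁻¹ u)`; the model of the
normed space `ℝ × EM` is the product model, `modelWithCornersSelf_prod`). [folklore] -/
theorem contMDiffOn_chartFamily (y₀ : M) :
    ContMDiffOn 𝓘(ℝ, ℝ × EM) IN ∞ (fun q : ℝ × EM ↦ F q.1 ((extChartAt IM y₀).symm q.2))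
      ((univ : Set ℝ) ×ˢ (extChartAt IM y₀).target) := by
  have hG : ContMDiffOn (𝓘(ℝ, ℝ).prod 𝓘(ℝ, EM)) (𝓘(ℝ, ℝ).prod IM) ∞
      (fun q : ℝ × EM ↦ ((q.1, (extChartAt IM y₀).symm q.2) : ℝ × M))
      ((univ : Set ℝ) ×ˢ (extChartAt IM y₀).target) :=
    contMDiffOn_fst.prodMk ((contMDiffOn_extChartAt_symm y₀).comp contMDiffOn_snd
      fun q hq ↦ hq.2)
  have h1 : ContMDiffOn (𝓘(ℝ, ℝ).prod 𝓘(ℝ, EM)) IN ∞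
      (fun q : ℝ × EM ↦ F q.1 ((extChartAt IM y₀).symm q.2))
      ((univ : Set ℝ) ×ˢ (extChartAt IM y₀).target) := hF.comp_contMDiffOn hG
  rw [modelWithCornersSelf_prod, ← chartedSpaceSelf_prod]
  exact h1

omit [FiniteDimensional ℝ EM] [FiniteDimensional ℝ EN] [CompleteSpace EN] [h.HasLeviCivita] in
/-- **The variation field `∂ₜF(t₀, ·)` of a smooth family is a smooth field along the stage
`F t₀`**: the lift `y ↦ (F t₀ y, ∂ₜF(t₀, y)) ∈ TN` is `C^∞`. With the family read in the chart
`φ` of `M` at `y₀`, `P(t, u) = F t (φ⁻¹ u)` (`contMDiffOn_chartFamily`), it is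
`q ↦ (P q, dP_q(1, 0))` (`contMDiffAt_lift_mfderiv_const'`) composed with `y ↦ (t₀, φ y)`
(O'Neill 1983, Ch. 4, p. 122: the partial velocities of a two-parameter map are smooth vector
fields on it). [cite: ONeill1983, Ch. 4, p. 122] -/
theorem contMDiff_lift_velocity_stage (t₀ : ℝ) :
    ContMDiff IM IN.tangent ∞ (fun y ↦ (TotalSpace.mk' EN (F t₀ y)
      (velocity IN (fun t ↦ F t y) t₀) : TangentBundle IN N)) := by
  intro y₀
  set φ := extChartAt IM y₀ with hφ
  set D : Set (ℝ × EM) := (univ : Set ℝ) ×ˢ φ.target with hD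
  have hDo : IsOpen D := isOpen_univ.prod (isOpen_extChartAt_target y₀)
  set P : ℝ × EM → N := fun q ↦ F q.1 (φ.symm q.2) with hP
  have hPs : ContMDiffOn 𝓘(ℝ, ℝ × EM) IN ∞ P D := contMDiffOn_chartFamily hF y₀
  set ψ : M → ℝ × EM := fun y ↦ (t₀, φ y) with hψ
  have hψs : ContMDiffOn IM 𝓘(ℝ, ℝ × EM) ∞ ψ (chartAt HM y₀).source := fun y hy ↦
    contMDiffWithinAt_const.prodMk_space
      ((contMDiffOn_extChartAt (I := IM) (n := ∞) (x := y₀)) y hy)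
  have hy₀ : y₀ ∈ (chartAt HM y₀).source := mem_chart_source HM y₀
  have hq : ψ y₀ ∈ D := ⟨mem_univ _, φ.map_source (mem_extChartAt_source y₀)⟩
  have hL := contMDiffAt_lift_mfderiv_const' hDo hPs hq ((1 : ℝ), (0 : EM))
  have hcomp := hL.comp y₀ ((hψs y₀ hy₀).contMDiffAt ((chartAt HM y₀).open_source.mem_nhds hy₀))
  refine hcomp.congr_of_eventuallyEq ?_
  filter_upwards [(chartAt HM y₀).open_source.mem_nhds hy₀] with y hy
  have hys : y ∈ φ.source := by simpa [hφ] using hy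
  have hyD : ψ y ∈ D := ⟨mem_univ _, φ.map_source hys⟩
  have hPd : MDifferentiableAt 𝓘(ℝ, ℝ × EM) IN P (ψ y) :=
    (hPs.contMDiffAt (hDo.mem_nhds hyD)).mdifferentiableAt (by simp)
  have hvel := velocity_eq_mfderiv_chart (P := P) (t := t₀) (u := φ y) hPd
  have hback : φ.symm (φ y) = y := φ.left_inv hys
  show (TotalSpace.mk' EN (F t₀ y) (velocity IN (fun t ↦ F t y) t₀) : TangentBundle IN N) =
    TotalSpace.mk' EN (P (ψ y)) (mfderiv 𝓘(ℝ, ℝ × EM) IN P (ψ y) ((1 : ℝ), (0 : EM)))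
  have hfun : (fun t ↦ F t y) = fun t' ↦ P (t', φ y) := by
    funext t
    simp only [hP, hback]
  congr 1
  · simp only [hP, hψ, hback]
  · rw [hfun]
    exact hvel

end VariationField

/-! ### Step 2: the dual field `Y_V = (h(V, dφ ·))^♯` and its covariant derivative -/

section StepTwo

variable [CompleteSpace EM]
  (g : ContMDiffRiemannianMetric IM ∞ EM (TangentSpace IM : M → Type _))
  [(ofRiemannian g).HasLeviCivita]
  {φ : M → N} (hφ : ContMDiff IM IN ∞ φ)
  {V : Π y : M, TangentSpace IN (φ y)}
  (hV : ContMDiff IM IN.tangent ∞ (fun y ↦ (TotalSpace.mk' EN (φ y) (V y) : TangentBundle IN N)))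

omit [IM.Boundaryless] [CompleteSpace EM] [(ofRiemannian g).HasLeviCivita]
  [FiniteDimensional ℝ EN] [CompleteSpace EN] [h.HasLeviCivita] in
/-- **Defining property of the dual field** `Y_V = (h(V, dφ ·))^♯` of a field `V` along `φ`:
`g(Y_V, Z) = h(V, dφ Z)` (`val_sharp_apply`). This is the vector field on `M` whose divergence
carries the integration by parts of Eells–Ratto 1993, Ch. I, proof of (1.9), Step 2.
[cite: EellsRatto1993, Ch. I (1.9), proof, Step 2] -/
theorem val_sharp_varDual (y : M) (Z : TangentSpace IM y) :
    (ofRiemannian g).val y ((ofRiemannian g).sharp y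
      (((h.val (φ y) (V y)).comp (mfderiv IM IN φ y) : TangentSpace IM y →L[ℝ] ℝ) :
        TangentSpace IM y →ₗ[ℝ] ℝ)) Z = h.val (φ y) (V y) (mfderiv IM IN φ y Z) := by
  rw [val_sharp_apply]
  rfl

include hφ in
omit [IM.Boundaryless] [FiniteDimensional ℝ EM] [FiniteDimensional ℝ EN] [CompleteSpace EN]
  [h.HasLeviCivita] [CompleteSpace EM] in
/-- The field `y ↦ dφ_y(Z_y)` along `φ` has a `C^∞` lift for `C^∞` `φ` and `Z` (the tangent map of
`φ` composed with the section `Z`). [folklore] -/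
theorem contMDiffAt_lift_mfderiv_apply {Z : Π y : M, TangentSpace IM y} {x : M}
    (hZ : CMDiffAt ∞ (T% Z) x) :
    ContMDiffAt IM IN.tangent ∞
      (fun y ↦ (TotalSpace.mk' EN (φ y) (mfderiv IM IN φ y (Z y)) : TangentBundle IN N)) x :=
  (hφ.contMDiff_tangentMap (le_of_eq rfl)).contMDiffAt.comp x hZ

include hφ hV in
omit [CompleteSpace EM] [(ofRiemannian g).HasLeviCivita] [IM.Boundaryless] [FiniteDimensional ℝ EN]
  [CompleteSpace EN] [h.HasLeviCivita] in
/-- **The dual field `Y_V` is a smooth vector field**: on the chart domain of `y₀`,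
`Y_V = ∑ₗ (∑ₖ h(V, dφ ∂ₖ) 𝒢^{kl}) ∂ₗ` (`eq_sum_gram_inv_smul_localFrame`) with `C^∞` coefficients
(`contMDiffAt_val_apply_along`, `contMDiffOn_gram_localFrame_inv`). [folklore] -/
theorem contMDiff_varDual :
    CMDiff ∞ (T% (fun y : M ↦ (ofRiemannian g).sharp y
      (((h.val (φ y) (V y)).comp (mfderiv IM IN φ y) : TangentSpace IM y →L[ℝ] ℝ) :
        TangentSpace IM y →ₗ[ℝ] ℝ))) := by
  classical
  set bE := Module.finBasis ℝ EM with hbE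
  intro y₀
  set e := trivializationAt EM (TangentSpace IM : M → Type _) y₀ with he
  have hy₀ : y₀ ∈ (chartAt HM y₀).source := mem_chart_source HM y₀
  have hs : ∀ k, CMDiff[(chartAt HM y₀).source] ∞ (T% (e.localFrame bE k)) := fun k y hy ↦
    (contMDiffAt_localFrame_chart bE hy k).contMDiffWithinAt
  -- the coefficient functions
  set c : Fin (Module.finrank ℝ EM) → M → ℝ := fun l y ↦
    ∑ k, h.val (φ y) (V y) (mfderiv IM IN φ y (e.localFrame bE k y)) *
      (Matrix.of fun i j ↦ (ofRiemannian g).val y (e.localFrame bE i y)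
        (e.localFrame bE j y))⁻¹ k l with hc
  have hcoef : ∀ l, CMDiff[(chartAt HM y₀).source] ∞ (c l) := by
    intro l y hy
    refine (contMDiffAt_finsetSum fun k _ ↦ ?_).contMDiffWithinAt
    have hye : y ∈ e.baseSet := by simpa [he] using hy
    refine (contMDiffAt_val_apply_along (g := h) le_rfl (hV y) ?_).mul ?_
    · exact contMDiffAt_lift_mfderiv_apply hφ ((hs k y hy).contMDiffAt
        ((chartAt HM y₀).open_source.mem_nhds hy))
    · exact (contMDiffOn_gram_localFrame_inv e (ofRiemannian g) bE k l y hye).contMDiffAt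
        (e.open_baseSet.mem_nhds hye)
  have formula : ∀ y ∈ (chartAt HM y₀).source,
      (ofRiemannian g).sharp y (((h.val (φ y) (V y)).comp (mfderiv IM IN φ y) :
        TangentSpace IM y →L[ℝ] ℝ) : TangentSpace IM y →ₗ[ℝ] ℝ) =
        ∑ l, c l y • e.localFrame bE l y := by
    intro y hy
    have hexp := eq_sum_gram_inv_smul_localFrame (ofRiemannian g) bE hy
      ((ofRiemannian g).sharp y (((h.val (φ y) (V y)).comp (mfderiv IM IN φ y) :
        TangentSpace IM y →L[ℝ] ℝ) : TangentSpace IM y →ₗ[ℝ] ℝ))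
    simp only [val_sharp_varDual] at hexp
    exact hexp
  have hsum : CMDiff[(chartAt HM y₀).source] ∞ (T% (fun y ↦ ∑ l, c l y • e.localFrame bE l y)) :=
    ContMDiffOn.sum_section fun l _ ↦ (hcoef l).smul_section (hs l)
  have hloc : CMDiff[(chartAt HM y₀).source] ∞ (T% (fun y : M ↦ (ofRiemannian g).sharp y
      (((h.val (φ y) (V y)).comp (mfderiv IM IN φ y) : TangentSpace IM y →L[ℝ] ℝ) :
        TangentSpace IM y →ₗ[ℝ] ℝ))) :=
    hsum.congr fun y hy ↦ by
      rw [Bundle.TotalSpace.mk_inj]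
      exact formula y hy
  exact (hloc y₀ hy₀).contMDiffAt ((chartAt HM y₀).open_source.mem_nhds hy₀)

include hφ hV in
omit [CompleteSpace EM] [(ofRiemannian g).HasLeviCivita] [FiniteDimensional ℝ EM] in
/-- **The derivative of `y ↦ h(V_y, dφ_y Z_y)` in the direction `w`** is
`h(D_w V, dφ Z_x) + h(V_x, D_w(dφ Z))`, `D_w` the covariant derivative along `φ`
(`normalDerivAlong`): the product rule for the Levi-Civita connection of `h` along the
chart-straight curve through `x` with velocity `w` (`hasDerivAt_val_apply_along`) and the chain
rule (`hasDerivAt_comp_curve_vec`). This is the computation `X⟨v, dφ·Y⟩ = ⟨∇^φ_X v, dφ·Y⟩ +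
⟨v, ∇^φ_X(dφ·Y)⟩` of Eells–Ratto 1993, Ch. I, proof of (1.9), Step 2.
[cite: EellsRatto1993, Ch. I (1.9), proof, Step 2] -/
theorem mvfderiv_val_mfderiv_apply {Z : Π y : M, TangentSpace IM y} {x : M}
    (hZ : CMDiffAt ∞ (T% Z) x) (w : TangentSpace IM x) :
    mvfderiv IM (fun y ↦ h.val (φ y) (V y) (mfderiv IM IN φ y (Z y))) x w =
      h.val (φ x) (h.normalDerivAlong φ V x w) (mfderiv IM IN φ x (Z x)) +
        h.val (φ x) (V x) (h.normalDerivAlong φ (fun y ↦ mfderiv IM IN φ y (Z y)) x w) := by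
  have hcompat : h.IsCompatible h.leviCivita := (isLeviCivita_leviCivita_holds (g := h)).2
  set c := curveThrough IM x w with hc_def
  have hc : MDifferentiableAt 𝓘(ℝ, ℝ) IM c 0 :=
    (contMDiffAt_curveThrough_zero (n := 1) x w).mdifferentiableAt one_ne_zero
  have hc0 : c 0 = x := curveThrough_zero IM x w
  have hcv : velocity IM c 0 = w :=
    velocity_curveThrough_zero_holds BoundarylessManifold.isInteriorPoint w
  have hdZ : ContMDiffAt IM IN.tangent ∞
      (fun y ↦ (TotalSpace.mk' EN (φ y) (mfderiv IM IN φ y (Z y)) : TangentBundle IN N)) x :=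
    contMDiffAt_lift_mfderiv_apply hφ hZ
  have hf : ContMDiffAt IM 𝓘(ℝ, ℝ) ∞ (fun y ↦ h.val (φ y) (V y) (mfderiv IM IN φ y (Z y))) x :=
    contMDiffAt_val_apply_along (g := h) le_rfl (hV x) hdZ
  -- I: the chain rule along `c`
  have hf0 : MDifferentiableAt IM 𝓘(ℝ, ℝ) (fun y ↦ h.val (φ y) (V y) (mfderiv IM IN φ y (Z y)))
      (c 0) := by
    rw [hc0]; exact hf.mdifferentiableAt (by simp)
  have h1 := hasDerivAt_comp_curve_vec hf0 hc
  rw [hc0, hcv] at h1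
  -- II: the product rule along `c`
  have hVc : MDifferentiableAt 𝓘(ℝ, ℝ) IN.tangent
      (fun t ↦ (TotalSpace.mk' EN (φ (c t)) (V (c t)) : TangentBundle IN N)) 0 := by
    have hV0 : ContMDiffAt IM IN.tangent ∞
        (fun y ↦ (TotalSpace.mk' EN (φ y) (V y) : TangentBundle IN N)) (c 0) := hV (c 0)
    exact (hV0.mdifferentiableAt (by simp)).comp 0 hc
  have hWc : MDifferentiableAt 𝓘(ℝ, ℝ) IN.tangent
      (fun t ↦ (TotalSpace.mk' EN (φ (c t)) (mfderiv IM IN φ (c t) (Z (c t))) :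
        TangentBundle IN N)) 0 := by
    have hdZ0 : ContMDiffAt IM IN.tangent ∞
        (fun y ↦ (TotalSpace.mk' EN (φ y) (mfderiv IM IN φ y (Z y)) : TangentBundle IN N))
        (c 0) := by
      rw [hc0]; exact hdZ
    exact (hdZ0.mdifferentiableAt (by simp)).comp 0 hc
  have h2 := hasDerivAt_val_apply_along (g := h) hcompat (γ := fun t ↦ φ (c t)) hVc hWc
  have key := h1.unique h2
  rw [hc0] at key
  exact key

include hφ hV in
/-- **`g(∇_w Y_V, Z) = h(D_w V, dφ Z) + h(V, ∇dφ(w, Z))`** — the covariant derivative of the dual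
field (Eells–Ratto 1993, Ch. I, proof of (1.9), Step 2: with `∇^* ρ = −gⁱʲ(∇_{∂ᵢ}ρ)(∂ⱼ)`,
"`∫⟨∇^φ v, dφ⟩ = ∫⟨v, ∇^* dφ⟩`" rests on `⟨∇v, dφ⟩ = div(·) − ⟨v, ∇^*dφ⟩`, i.e. on this
pointwise identity): metric compatibility of the Levi-Civita connection of `g`
(`IsCompatible`) applied to `Y_V`, the extension of `w` and the field `Z`, together with
`mvfderiv_val_mfderiv_apply` and the definition of the second fundamental form `secondFF`.
[cite: EellsRatto1993, Ch. I (1.9), proof, Step 2] -/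
theorem val_leviCivita_varDual {Z : Π y : M, TangentSpace IM y} {x : M}
    (hZ : CMDiffAt ∞ (T% Z) x) (w : TangentSpace IM x) :
    (ofRiemannian g).val x ((ofRiemannian g).leviCivita (fun y : M ↦ (ofRiemannian g).sharp y
      (((h.val (φ y) (V y)).comp (mfderiv IM IN φ y) : TangentSpace IM y →L[ℝ] ℝ) :
        TangentSpace IM y →ₗ[ℝ] ℝ)) x w) (Z x) =
      h.val (φ x) (h.normalDerivAlong φ V x w) (mfderiv IM IN φ x (Z x)) +
        h.val (φ x) (V x) (secondFF g h φ x w Z) := by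
  have hGcompat : (ofRiemannian g).IsCompatible (ofRiemannian g).leviCivita :=
    (isLeviCivita_leviCivita_holds (g := ofRiemannian g)).2
  set Xw : Π y : M, TangentSpace IM y := FiberBundle.extend EM w with hXw
  have hXw0 : Xw x = w := FiberBundle.extend_apply_self (F := EM) w
  have hXws : MDiffAt (T% Xw) x :=
    (FiberBundle.contMDiffAt_extend (I := IM) (F := EM) (V := (TangentSpace IM : M → Type _))
      (k := 1) w).mdifferentiableAt one_ne_zero
  have hY : MDiffAt (T% (fun y : M ↦ (ofRiemannian g).sharp y
      (((h.val (φ y) (V y)).comp (mfderiv IM IN φ y) : TangentSpace IM y →L[ℝ] ℝ) :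
        TangentSpace IM y →ₗ[ℝ] ℝ))) x :=
    (contMDiff_varDual h g hφ hV x).mdifferentiableAt (by simp)
  have hZd : MDiffAt (T% Z) x := hZ.mdifferentiableAt (by simp)
  have hc := hGcompat hXws hY hZd
  rw [hXw0] at hc
  have hfun : (fun y ↦ (ofRiemannian g).val y ((ofRiemannian g).sharp y
      (((h.val (φ y) (V y)).comp (mfderiv IM IN φ y) : TangentSpace IM y →L[ℝ] ℝ) :
        TangentSpace IM y →ₗ[ℝ] ℝ)) (Z y)) =
      fun y ↦ h.val (φ y) (V y) (mfderiv IM IN φ y (Z y)) :=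
    funext fun y ↦ val_sharp_varDual h g y (Z y)
  rw [hfun, mvfderiv_val_mfderiv_apply h hφ hV hZ w, val_sharp_varDual] at hc
  rw [secondFF, map_sub]
  linarith [hc]

/-! ### The divergence of the dual field -/

omit hφ hV [IM.Boundaryless] [CompleteSpace EM] [(ofRiemannian g).HasLeviCivita] [FiniteDimensional ℝ EN]
  [CompleteSpace EN] [IsManifold IN ∞ N] [h.HasLeviCivita] in
/-- **Trace of an endomorphism in the coordinate frame through the metric**: for
`A ∈ End(T_x M)`, `tr A = ∑ᵢⱼ (𝒢⁻¹)ⱼᵢ g(A ∂ᵢ, ∂ⱼ)` in the local frame `∂ᵢ` of the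
trivialisation of `TM` at `x` with Gram matrix `𝒢` (`trace_eq_sum_gram_inv` for the bilinear
form `(v, w) ↦ g(Av, w)`, whose `♯`-raising is `A`: `♯(g(Av, ·)) = Av`, `sharp_flat`).
[folklore] -/
theorem linearMapTrace_eq_sum_gram_inv (x : M) (A : TangentSpace IM x →ₗ[ℝ] TangentSpace IM x) :
    LinearMap.trace ℝ (TangentSpace IM x) A = ∑ i, ∑ j,
      (Matrix.of fun i j ↦ (ofRiemannian g).val x
          ((trivializationAt EM (TangentSpace IM : M → Type _) x).localFrame
            (Module.finBasis ℝ EM) i x)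
          ((trivializationAt EM (TangentSpace IM : M → Type _) x).localFrame
            (Module.finBasis ℝ EM) j x))⁻¹ j i *
        (ofRiemannian g).val x
          (A ((trivializationAt EM (TangentSpace IM : M → Type _) x).localFrame
            (Module.finBasis ℝ EM) i x))
          ((trivializationAt EM (TangentSpace IM : M → Type _) x).localFrame
            (Module.finBasis ℝ EM) j x) := by
  classical
  have hx : x ∈ (trivializationAt EM (TangentSpace IM : M → Type _) x).baseSet :=
    FiberBundle.mem_baseSet_trivializationAt' x
  set B : LinearMap.BilinForm ℝ (TangentSpace IM x) := ((ofRiemannian g).flat x).comp A with hB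
  have hsharp : ((ofRiemannian g).sharp x).toLinearMap ∘ₗ B = A := by
    ext v
    simp [hB]
  have htr : (ofRiemannian g).trace x B = LinearMap.trace ℝ (TangentSpace IM x) A := by
    rw [PseudoRiemannianMetric.trace, hsharp]
  rw [← htr, trace_eq_sum_gram_inv (ofRiemannian g) x
    ((trivializationAt EM (TangentSpace IM : M → Type _) x).basisAt (Module.finBasis ℝ EM) hx)]
  simp only [(trivializationAt EM (TangentSpace IM : M → Type _) x).localFrame_apply_of_mem_baseSet
    (Module.finBasis ℝ EM) hx, hB, LinearMap.comp_apply, flat_apply]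

include hφ hV in
/-- **The divergence of the dual field `Y_V`** in the coordinate frame at `x`
(Eells–Ratto 1993, Ch. I, proof of (1.9), Step 2, pointwise: `⟨∇^φ v, dφ⟩ + ⟨v, Trace ∇dφ⟩` is a
divergence): `div Y_V (x) = ∑ᵢⱼ (𝒢⁻¹)ⱼᵢ [h(D_{∂ᵢ} V, dφ ∂ⱼ) + h(V, ∇dφ(∂ᵢ, ∂ⱼ))]`
(`linearMapTrace_eq_sum_gram_inv` and `val_leviCivita_varDual` on the frame fields).
[cite: EellsRatto1993, Ch. I (1.9), proof, Step 2] -/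
theorem vectorDivergence_varDual_eq_sum (x : M) :
    (ofRiemannian g).vectorDivergence (fun y : M ↦ (ofRiemannian g).sharp y
      (((h.val (φ y) (V y)).comp (mfderiv IM IN φ y) : TangentSpace IM y →L[ℝ] ℝ) :
        TangentSpace IM y →ₗ[ℝ] ℝ)) x = ∑ i, ∑ j,
      (Matrix.of fun i j ↦ (ofRiemannian g).val x
          ((trivializationAt EM (TangentSpace IM : M → Type _) x).localFrame
            (Module.finBasis ℝ EM) i x)
          ((trivializationAt EM (TangentSpace IM : M → Type _) x).localFrame
            (Module.finBasis ℝ EM) j x))⁻¹ j i *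
        (h.val (φ x) (h.normalDerivAlong φ V x
            ((trivializationAt EM (TangentSpace IM : M → Type _) x).localFrame
              (Module.finBasis ℝ EM) i x))
            (mfderiv IM IN φ x ((trivializationAt EM (TangentSpace IM : M → Type _) x).localFrame
              (Module.finBasis ℝ EM) j x)) +
          h.val (φ x) (V x) (secondFF g h φ x
            ((trivializationAt EM (TangentSpace IM : M → Type _) x).localFrame
              (Module.finBasis ℝ EM) i x)
            ((trivializationAt EM (TangentSpace IM : M → Type _) x).localFrame
              (Module.finBasis ℝ EM) j))) := by
  have hx : x ∈ (chartAt HM x).source := mem_chart_source HM x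
  rw [vectorDivergence_def, linearMapTrace_eq_sum_gram_inv g x]
  refine Finset.sum_congr rfl fun i _ ↦ Finset.sum_congr rfl fun j _ ↦ ?_
  congr 1
  rw [ContinuousLinearMap.coe_coe]
  exact val_leviCivita_varDual h g hφ hV
    (contMDiffAt_localFrame_chart (Module.finBasis ℝ EM) hx j) _

end StepTwo

/-! ### The pointwise first-variation identity `∂ₜe(F_t) = div Y_V − h(V, τ(φ))` -/

section Pointwise

variable [CompleteSpace EM]
  (g : ContMDiffRiemannianMetric IM ∞ EM (TangentSpace IM : M → Type _))
  [(ofRiemannian g).HasLeviCivita]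

omit [IM.Boundaryless] [CompleteSpace EM] [(ofRiemannian g).HasLeviCivita] [FiniteDimensional ℝ EN]
  [CompleteSpace EN] [IsManifold IN ∞ N] [h.HasLeviCivita] in
/-- The inverse Gram matrix of the coordinate frame is symmetric (the Gram matrix is, by the
symmetry of the metric; `Matrix.transpose_nonsing_inv`). [folklore] -/
theorem gramInv_symm (x : M) (i j : Fin (Module.finrank ℝ EM)) :
    (Matrix.of fun i j ↦ (ofRiemannian g).val x
        ((trivializationAt EM (TangentSpace IM : M → Type _) x).localFrame
          (Module.finBasis ℝ EM) i x)
        ((trivializationAt EM (TangentSpace IM : M → Type _) x).localFrame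
          (Module.finBasis ℝ EM) j x))⁻¹ i j =
      (Matrix.of fun i j ↦ (ofRiemannian g).val x
        ((trivializationAt EM (TangentSpace IM : M → Type _) x).localFrame
          (Module.finBasis ℝ EM) i x)
        ((trivializationAt EM (TangentSpace IM : M → Type _) x).localFrame
          (Module.finBasis ℝ EM) j x))⁻¹ j i := by
  set G : Matrix (Fin (Module.finrank ℝ EM)) (Fin (Module.finrank ℝ EM)) ℝ :=
    Matrix.of fun i j ↦ (ofRiemannian g).val x
      ((trivializationAt EM (TangentSpace IM : M → Type _) x).localFrame
        (Module.finBasis ℝ EM) i x)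
      ((trivializationAt EM (TangentSpace IM : M → Type _) x).localFrame
        (Module.finBasis ℝ EM) j x) with hG
  have hGt : G.transpose = G := by
    ext a b
    simp only [hG, Matrix.transpose_apply, Matrix.of_apply]
    exact (ofRiemannian g).symm x _ _
  have h1 : (G⁻¹).transpose = G⁻¹ := by rw [Matrix.transpose_nonsing_inv, hGt]
  have h2 := congr_fun (congr_fun h1 j) i
  rw [Matrix.transpose_apply] at h2
  exact h2

variable {F : ℝ → M → N}
  (hF : ContMDiff (𝓘(ℝ, ℝ).prod IM) IN ∞ (fun p : ℝ × M ↦ F p.1 p.2))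
include hF

/-- **The pointwise first-variation identity** (Eells–Ratto 1993, Ch. I, proof of (1.9),
Steps 1–2 combined, before integration): for a smooth deformation `F`, at every `x ∈ M` and time
`t₀`, with `φ = F t₀`, `V = ∂ₜF(t₀, ·)` and `Y_V = (h(V, dφ·))^♯`,
`∂ₜ e(F_t)(x)|_{t₀} = div Y_V (x) − h(V_x, τ(φ)(x))`.
Here `div` is `PseudoRiemannianMetric.vectorDivergence` (`DivergenceTheorem.lean`) and `τ` the
tension field `HarmonicMap.tensionField` (`TensionField.lean`). Proof: Step 1
(`hasDerivAt_energyDensity_stage`) symmetrised with `h(dφ ∂ᵢ, D_{∂ⱼ}V) = h(D_{∂ⱼ}V, dφ ∂ᵢ)` and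
the symmetry of `𝒢⁻¹` (`gramInv_symm`), Step 2 (`vectorDivergence_varDual_eq_sum`), and
`h(V, τ) = ∑ₖₗ (𝒢⁻¹)ₖₗ h(V, ∇dφ(∂ₖ, ∂ₗ))` (linearity). [cite: EellsRatto1993, Ch. I (1.9), proof, Steps 1–2] -/
theorem deriv_energyDensity_stage_eq (x : M) (t₀ : ℝ) :
    deriv (fun t ↦ energyDensity g h (F t) x) t₀ =
      (ofRiemannian g).vectorDivergence (fun y : M ↦ (ofRiemannian g).sharp y
        (((h.val (F t₀ y) (velocity IN (fun t ↦ F t y) t₀)).comp (mfderiv IM IN (F t₀) y) :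
          TangentSpace IM y →L[ℝ] ℝ) : TangentSpace IM y →ₗ[ℝ] ℝ)) x -
        h.val (F t₀ x) (velocity IN (fun t ↦ F t x) t₀) (tensionField g h (F t₀) x) := by
  classical
  -- abbreviations
  set fr : Fin (Module.finrank ℝ EM) → TangentSpace IM x := fun i ↦
    (trivializationAt EM (TangentSpace IM : M → Type _) x).localFrame (Module.finBasis ℝ EM) i x
    with hfr
  set Ginv : Matrix (Fin (Module.finrank ℝ EM)) (Fin (Module.finrank ℝ EM)) ℝ :=
    (Matrix.of fun i j ↦ (ofRiemannian g).val x
      ((trivializationAt EM (TangentSpace IM : M → Type _) x).localFrame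
        (Module.finBasis ℝ EM) i x)
      ((trivializationAt EM (TangentSpace IM : M → Type _) x).localFrame
        (Module.finBasis ℝ EM) j x))⁻¹ with hGinv
  have hGs : ∀ i j, Ginv i j = Ginv j i := fun i j ↦ gramInv_symm g x i j
  set V : Π y : M, TangentSpace IN (F t₀ y) := fun y ↦ velocity IN (fun t ↦ F t y) t₀ with hVdef
  set DV : Fin (Module.finrank ℝ EM) → TangentSpace IN (F t₀ x) := fun i ↦
    h.normalDerivAlong (F t₀) V x (fr i) with hDV
  set dφ : Fin (Module.finrank ℝ EM) → TangentSpace IN (F t₀ x) := fun i ↦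
    mfderiv IM IN (F t₀) x (fr i) with hdφ
  set S : Fin (Module.finrank ℝ EM) → Fin (Module.finrank ℝ EM) → TangentSpace IN (F t₀ x) :=
    fun i j ↦ secondFF g h (F t₀) x (fr i)
      ((trivializationAt EM (TangentSpace IM : M → Type _) x).localFrame (Module.finBasis ℝ EM) j)
    with hS
  have hV : ContMDiff IM IN.tangent ∞
      (fun y ↦ (TotalSpace.mk' EN (F t₀ y) (V y) : TangentBundle IN N)) :=
    contMDiff_lift_velocity_stage hF t₀
  -- Step 1, raw form
  have h1 : deriv (fun t ↦ energyDensity g h (F t) x) t₀ = (1 / 2 : ℝ) * ∑ i, ∑ j,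
      Ginv j i * (h.val (F t₀ x) (DV i) (dφ j) + h.val (F t₀ x) (dφ i) (DV j)) :=
    (hasDerivAt_energyDensity_stage h hF g x t₀).deriv
  -- symmetrisation of Step 1
  have h1' : (1 / 2 : ℝ) * ∑ i, ∑ j,
      Ginv j i * (h.val (F t₀ x) (DV i) (dφ j) + h.val (F t₀ x) (dφ i) (DV j)) =
      ∑ i, ∑ j, Ginv j i * h.val (F t₀ x) (DV i) (dφ j) := by
    have hswap : ∑ i, ∑ j, Ginv j i * h.val (F t₀ x) (dφ i) (DV j) =
        ∑ i, ∑ j, Ginv j i * h.val (F t₀ x) (DV i) (dφ j) := by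
      rw [Finset.sum_comm]
      refine Finset.sum_congr rfl fun i _ ↦ Finset.sum_congr rfl fun j _ ↦ ?_
      rw [hGs i j, h.symm (F t₀ x) (dφ j) (DV i)]
    simp only [mul_add, Finset.sum_add_distrib, hswap]
    ring
  -- Step 2
  have h2 := vectorDivergence_varDual_eq_sum h g (contMDiff_stage hF t₀) hV x
  -- `h(V, τ) = ∑ (𝒢⁻¹)ₖₗ h(V, ∇dφ(∂ₖ, ∂ₗ))`
  have h3 : h.val (F t₀ x) (V x) (tensionField g h (F t₀) x) =
      ∑ i, ∑ j, Ginv j i * h.val (F t₀ x) (V x) (S i j) := by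
    rw [tensionField_eq]
    simp only [map_sum, map_smul, smul_eq_mul]
    refine Finset.sum_congr rfl fun i _ ↦ Finset.sum_congr rfl fun j _ ↦ ?_
    rw [hGs j i]
  rw [h1, h1', h2, h3]
  simp only [mul_add, Finset.sum_add_distrib]
  ring

end Pointwise

/-! ### Step 3: integration over a closed manifold — the first-variation formula and
`τ(φ) ≡ 0 ⇒ φ` is harmonic -/

section Integrated

open MeasureTheory

/-- Slices of a continuous function on a product are continuous (helper, stated to avoid
higher-order unification on concrete integrands). [folklore] -/
private theorem continuous_slice_fst' {X Y Z : Type*} [TopologicalSpace X] [TopologicalSpace Y]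
    [TopologicalSpace Z] {f : X × Y → Z} (hf : Continuous f) (y : Y) :
    Continuous fun x => f (x, y) :=
  hf.comp (continuous_id.prodMk continuous_const)

variable {m : ℕ} {HM₂ : Type*} [TopologicalSpace HM₂]
  {IM₂ : ModelWithCorners ℝ (EuclideanSpace ℝ (Fin m)) HM₂} [IM₂.Boundaryless]
  {M₂ : Type*} [TopologicalSpace M₂] [ChartedSpace HM₂ M₂] [IsManifold IM₂ ∞ M₂]
  [CompactSpace M₂] [T3Space M₂] [MeasurableSpace M₂] [BorelSpace M₂]
  (g : ContMDiffRiemannianMetric IM₂ ∞ (EuclideanSpace ℝ (Fin m)) (TangentSpace IM₂ : M₂ → Type _))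
  [(ofRiemannian g).HasLeviCivita]

/-- **The first-variation formula for the energy** (Eells–Ratto 1993, Ch. I, (1.9), proof,
Steps 1–2: "`dE(φ_t)/dt|₀ = ∫_M ⟨∇^φ v, dφ⟩ dx = ∫_M ⟨v, ∇^* dφ⟩ dx`", with `∇^*dφ = −τ(φ)`;
Eells–Sampson 1964, §2), on a compact Riemannian manifold `(M, g)` without boundary (modelled
on `ℝ^m`, boundaryless model) and at every time `t₀` of a `C^∞` deformation `F`:
`d/dt|_{t₀} E(F_t) = −∫_M h(τ(F_{t₀})(x), ∂ₜF(t₀, x)) dμ_g(x)`.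
Proof: `d/dt E(F_t) = ∫ ∂ₜ e(F_t) dμ_g` (`hasDerivAt_energy_family`,
`EnergyMinimisingMaps.lean`), `∂ₜe = div Y_V − h(V, τ)` pointwise
(`deriv_energyDensity_stage_eq`) and `∫ div Y_V dμ_g = 0` (the divergence theorem,
`integral_vectorDivergence_eq_zero`, `DivergenceTheorem.lean`).
[cite: EellsRatto1993, Ch. I (1.9), proof, Steps 1–2] [cite: EellsSampson1964, §2] -/
theorem hasDerivAt_energy_stage_eq_neg_integral {F : ℝ → M₂ → N}
    (hF : ContMDiff (𝓘(ℝ, ℝ).prod IM₂) IN ∞ (fun p : ℝ × M₂ ↦ F p.1 p.2)) (t₀ : ℝ) :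
    HasDerivAt (fun t ↦ energy g h (F t))
      (-∫ x, h.val (F t₀ x) (tensionField g h (F t₀) x) (velocity IN (fun t ↦ F t x) t₀)
        ∂riemannianMeasure g) t₀ := by
  have hd := hasDerivAt_energy_family g h hF t₀
  -- the dual field `Y_V` of the variation field is `C¹`, so the divergence theorem applies
  have hV : ContMDiff IM₂ IN.tangent ∞ (fun y ↦ (TotalSpace.mk' EN (F t₀ y)
      (velocity IN (fun t ↦ F t y) t₀) : TangentBundle IN N)) := contMDiff_lift_velocity_stage hF t₀
  have hY := contMDiff_varDual h g (contMDiff_stage hF t₀) hV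
  obtain ⟨hdivc, hdiv0⟩ := integral_vectorDivergence_eq_zero g (hY.of_le (by norm_cast))
  -- the time derivative of the energy density is continuous in `x`
  have hderc : Continuous fun x ↦ deriv (fun s ↦ energyDensity g h (F s) x) t₀ :=
    continuous_slice_fst' (continuous_deriv_time (u := fun t x ↦ energyDensity g h (F t) x)
      (contMDiff_energyDensity_family g h hF)) t₀
  -- the pointwise identity, rearranged: `h(τ, V) = div Y_V − ∂ₜe`
  have hpt : ∀ x, h.val (F t₀ x) (tensionField g h (F t₀) x) (velocity IN (fun t ↦ F t x) t₀) =
      (ofRiemannian g).vectorDivergence (fun y : M₂ ↦ (ofRiemannian g).sharp y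
        (((h.val (F t₀ y) (velocity IN (fun t ↦ F t y) t₀)).comp (mfderiv IM₂ IN (F t₀) y) :
          TangentSpace IM₂ y →L[ℝ] ℝ) : TangentSpace IM₂ y →ₗ[ℝ] ℝ)) x -
        deriv (fun s ↦ energyDensity g h (F s) x) t₀ := by
    intro x
    rw [deriv_energyDensity_stage_eq h g hF x t₀, h.symm (F t₀ x)]
    ring
  have hτc : Continuous fun x ↦ h.val (F t₀ x) (tensionField g h (F t₀) x)
      (velocity IN (fun t ↦ F t x) t₀) := by
    have heq : (fun x ↦ h.val (F t₀ x) (tensionField g h (F t₀) x)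
        (velocity IN (fun t ↦ F t x) t₀)) = fun x ↦
        (ofRiemannian g).vectorDivergence (fun y : M₂ ↦ (ofRiemannian g).sharp y
          (((h.val (F t₀ y) (velocity IN (fun t ↦ F t y) t₀)).comp (mfderiv IM₂ IN (F t₀) y) :
            TangentSpace IM₂ y →L[ℝ] ℝ) : TangentSpace IM₂ y →ₗ[ℝ] ℝ)) x -
          deriv (fun s ↦ energyDensity g h (F s) x) t₀ := funext hpt
    rw [heq]
    exact hdivc.sub hderc
  -- integrate
  have hval : ∫ x, deriv (fun s ↦ energyDensity g h (F s) x) t₀ ∂riemannianMeasure g =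
      -∫ x, h.val (F t₀ x) (tensionField g h (F t₀) x) (velocity IN (fun t ↦ F t x) t₀)
        ∂riemannianMeasure g := by
    have heq : (fun x ↦ deriv (fun s ↦ energyDensity g h (F s) x) t₀) = fun x ↦
        (ofRiemannian g).vectorDivergence (fun y : M₂ ↦ (ofRiemannian g).sharp y
          (((h.val (F t₀ y) (velocity IN (fun t ↦ F t y) t₀)).comp (mfderiv IM₂ IN (F t₀) y) :
            TangentSpace IM₂ y →L[ℝ] ℝ) : TangentSpace IM₂ y →ₗ[ℝ] ℝ)) x -
          h.val (F t₀ x) (tensionField g h (F t₀) x) (velocity IN (fun t ↦ F t x) t₀) := by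
      funext x
      rw [hpt x]
      ring
    rw [heq, integral_sub (integrable_of_continuous g hdivc) (integrable_of_continuous g hτc),
      hdiv0, zero_sub]
  exact hd.congr_deriv hval

/-- **A smooth map with vanishing tension field is harmonic** — the direction `τ(φ) ≡ 0 ⇒ φ`
critical of Eells–Ratto 1993, Ch. I, (1.9) Theorem ("A map `φ` is a critical point of `E` iff it
is harmonic", harmonic meaning `τ(φ) ≡ 0`, (1.7); Carlson–Müller-Stach–Peters 2017, p. 345,
Theorem "Characterization of harmonic maps", the converse direction: "The converse is obvious"),
for the tree's variational notion `IsHarmonicMap` (`HarmonicMaps.lean`), on a compact Riemannian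
manifold without boundary modelled on `ℝ^m`: by the first-variation formula
(`hasDerivAt_energy_stage_eq_neg_integral`) the derivative of `t ↦ E(F_t)` at `0` is
`−∫ h(τ(φ), ∂ₜF) dμ_g = 0` for every smooth deformation `F` of `φ = F 0`. This is the bridge by
which any analytic construction of a map with `τ = 0` (heat flow, minimisation) yields a
harmonic map in the sense of the named fact `eellsSampson_existence`.
[cite: EellsRatto1993, Ch. I (1.9)] [cite: CarlsonMullerStachPeters2017, §14.1, p. 345] -/
theorem isHarmonicMap_of_tensionField_eq_zero {φ : M₂ → N} (hφ : ContMDiff IM₂ IN ∞ φ)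
    (hτ : ∀ x, tensionField g h φ x = 0) : IsHarmonicMap g h φ := by
  refine ⟨hφ, fun F hF h0 ↦ ?_⟩
  have hd := hasDerivAt_energy_stage_eq_neg_integral h g hF 0
  subst h0
  simpa only [hτ, map_zero, zero_apply, integral_zero, neg_zero] using hd

end Integrated


end HarmonicMap

end Literature.Geometry.Riemannian

end
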